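import Summits.QuantumFields.YangMills.Theorems.BalabanUVNodesN10GenAnalyticReadingOfActivities

/-!
# BalabanUVNodes ∕ N10 → N22: the activity-level analytic-reading rows of module 101 are JOINTLY INHABITED, NON-DEGENERATELY — a generator that
# READS THE HISTORY (evaluation of the last older term) through an activity family LINEAR IN THE BANACH PARAMETER, with the located numerals (A2 of module 101)

Track A of `YM-PLAN.md` (cell `pub-ymgap`, HUMAN RULING D-0062), seat `pub-ymgap-dag-n10-c` g19, module 103 (A2 companion of module 101
`…Theorems.BalabanUVNodesN10GenAnalyticReadingOfActivities`, p663792; referee ref-K READ-342: «A2: inhabitation not exhibited (trivial inhabitant declared)»).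
THEOREMS ONLY (0 `def`, 0 `sorry`, standard axioms); `--supports stmt-QuantumFields-27364 --as helper`; COUNT-NEUTRAL.

WHAT.  On ANY torus `P`, cube size `M`, configuration algebra `𝔸`, space table `sp`, admissible class `Adm`, window `γ`, reference configuration `φ₀` and ball radius
`R > 0`, with `Pot k := ℂ`:
* ★ `activityReading_rows_inhabited` — there are a generator tower `G` (ONE generic term per polymer `Z`, `T Z t old φ := c_Z · ρ k old`), a reading
  `ρ k old := old_k(□₀; φ₀)` (EVALUATION of the last older term at the level-`k` cube `□₀` and `φ₀` — genuinely history-dependent, linear) and an activity reading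
  `h k t φ Z p := c_Z · p` (LINEAR in the Banach parameter, `c_Z = (A∕R)·e^{−R₃₈ d_{k+1}(Z)}`), together with numerals `A > 0`, `r₁ = 0`, `R₃₈ = 2κ₀(4·2^d, 2d) + 2`,
  satisfying ALL of module 101 §2's hypotheses — (H-fact) (everywhere, a fortiori on `Adm`∕`sp`), (H-holo), (H-38) on `ball 0 R`, `hrate`, `hsmall` (with EQUALITY:
  `A = (e·K₀·(2d+1)·4·2^d)⁻¹`) — AND `h k t φ Z 0 ≠ h k t φ Z (R∕2)` (the activity reading is NOT constant on the ball: not the trivial inhabitant).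
* ★ `genAnalyticReading_rows_inhabited` — hence module J57 §2's generator-level rows (AR-fact)∕(AR-holo)∕(AR-bound) are inhabited by a history-READING generator
  (module 101 `exists_genAnalyticReading_of_activityReading` on the witness), with the same non-degenerate activity reading underneath.
HONEST FRAMING (binding).  A2-style joint-satisfiability witness of DISPLAYED hypothesis rows by an explicit toy generator; it says nothing about Bałaban's generator of
record; NO estimate of Bałaban's is proved or asserted; N10 ∕ N22 NOT discharged; K1⁹ ∕ K3⁸ NOT closed; counts UNMOVED (5∕27); nothing continuum ∕ ℝ⁴ ∕ OS ∕ mass-gap ∕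
Clay.  References (TYPES only): [II] = Bałaban, CMP 116 (1988) (2.13)–(2.14) pp. 14–15, Lemma 3 (2.38) p. 20, (2.41) p. 21; [KP86] p. 492–493.
-/

noncomputable section

open Set Metric
open scoped BigOperators

namespace YMDAG.N10

open Literature.MathematicalPhysics.QuantumFieldTheory.Balaban1983to89
open Literature.MathematicalPhysics.QuantumFieldTheory.Balaban1983to89.B12TreeDecay (K₀ kappa₀ K₀_pos kappa₀_nonneg)
open Literature.MathematicalPhysics.QuantumFieldTheory.Balaban1983to89.B13Resummation (locE)
open Literature.MathematicalPhysics.QuantumFieldTheory.Balaban1983to89.TreeLengthTorusGeometry (tgeometry)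
open Literature.MathematicalPhysics.QuantumFieldTheory.Balaban1983to89.Node00.Sect2 (domSys domCount CPair cubeDom)
open Literature.MathematicalPhysics.QuantumFieldTheory.Balaban1983to89.Node00.W1

variable {P : Params} {𝔸 : Type} {M : ℕ} (sp : (k : ℕ) → (domSys P M (k + 1)).Dom → Set (CPair P 𝔸))
  (Adm : (k : ℕ) → OlderTerms P 𝔸 M k → Prop) (γ : ℝ) {R : ℝ}

/-- ★ **THE ACTIVITY-LEVEL ROWS OF MODULE 101 ARE JOINTLY INHABITED, NON-DEGENERATELY** (`Pot k := ℂ`).  With `A := (e·K₀(4·2^d,2d)·(2d+1)·4·2^d)⁻¹ > 0`, `r₁ := 0`,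
`R₃₈ := 2κ₀(4·2^d,2d) + 2`, `c_Z := (A∕R)·e^{−R₃₈ d_{k+1}(Z)}`: the generator tower with ONE generic term `c_Z · old_k(□₀; φ₀)` per polymer `Z` (it READS the history: evaluation of
the last older term at the level-`k` cube `□₀ = cubeDom P M k 0` and the reference configuration `φ₀`), the reading `ρ k old := old_k(□₀; φ₀)` and the activity reading
`h k t φ Z p := c_Z · p` satisfy (H-fact) (for ALL `t, old, X, φ, Z` — a fortiori on `Adm`, `sp`), (H-holo), (H-38) on `ball 0 R`, `hrate` and `hsmall` — and `h` is NOT constant on the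
ball (`h k t φ Z 0 ≠ h k t φ Z (R∕2)`). [folklore] -/
theorem activityReading_rows_inhabited (φ₀ : CPair P 𝔸) (hR : 0 < R) :
    ∃ (G : GenTower P 𝔸 M) (ρ : (k : ℕ) → OlderTerms P 𝔸 M k → ℂ) (h : (k : ℕ) → ℝ → CPair P 𝔸 → (domSys P M (k + 1)).Dom → ℂ → ℂ)
      (A R₃₈ r₁ : ℝ),
      0 < A ∧ 0 ≤ r₁ ∧ r₁ + 2 * kappa₀ (4 * 2 ^ P.d) (2 * P.d) + 2 ≤ R₃₈ ∧
      A * Real.exp (5 * r₁ + 1) * K₀ (4 * 2 ^ P.d) (2 * P.d) * (2 * (P.d : ℝ) + 1) * (4 * 2 ^ P.d) ≤ 1 ∧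
      (∀ (k : ℕ), ∀ t ∈ Ioc (0 : ℝ) γ, ∀ (old : OlderTerms P 𝔸 M k), Adm k old → ∀ (X : (domSys P M (k + 1)).Dom), ∀ φ ∈ sp k X,
        ∀ Z : (domSys P M (k + 1)).Dom, Subtype.val Z ⊆ Subtype.val X → (G k).H ((t : ℝ) : ℂ) old φ Z = h k t φ Z (ρ k old)) ∧
      (∀ (k : ℕ), ∀ t ∈ Ioc (0 : ℝ) γ, ∀ (X : (domSys P M (k + 1)).Dom), ∀ φ ∈ sp k X,
        ∀ Z : (domSys P M (k + 1)).Dom, Subtype.val Z ⊆ Subtype.val X → DifferentiableOn ℂ (h k t φ Z) (ball 0 R)) ∧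
      (∀ (k : ℕ), ∀ t ∈ Ioc (0 : ℝ) γ, ∀ (X : (domSys P M (k + 1)).Dom), ∀ φ ∈ sp k X,
        ∀ Z : (domSys P M (k + 1)).Dom, Subtype.val Z ⊆ Subtype.val X → ∀ p ∈ ball (0 : ℂ) R,
          ‖h k t φ Z p‖ ≤ A * Real.exp (-(R₃₈ * (domSys P M (k + 1)).dj Z))) ∧
      (∀ (k : ℕ) (t : ℝ) (φ : CPair P 𝔸) (Z : (domSys P M (k + 1)).Dom), h k t φ Z 0 ≠ h k t φ Z ((R / 2 : ℝ) : ℂ)) := by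
  -- the numerals
  set ν : ℝ := 2 * (P.d : ℝ) + 1 with hν
  set c₁ : ℝ := 4 * 2 ^ P.d with hc₁
  set Kc : ℝ := K₀ (4 * 2 ^ P.d) (2 * P.d) with hKc
  have hKpos : 0 < Kc := K₀_pos _ _
  have hprod : 0 < Real.exp 1 * Kc * ν * c₁ := by positivity
  set A : ℝ := (Real.exp 1 * Kc * ν * c₁)⁻¹ with hA
  have hApos : 0 < A := inv_pos.2 hprod
  set R₃₈ : ℝ := 2 * kappa₀ (4 * 2 ^ P.d) (2 * P.d) + 2 with hR₃₈
  -- the polymer weights `c_Z`, the reading `ρ` and the activity reading `h`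
  set cZ : (k : ℕ) → (domSys P M (k + 1)).Dom → ℝ := fun k Z => A / R * Real.exp (-(R₃₈ * (domSys P M (k + 1)).dj Z)) with hcZ
  have hcZpos : ∀ k Z, 0 < cZ k Z := fun k Z => by positivity
  have hR0 : R ≠ 0 := hR.ne'
  -- the generator (ONE generic term per polymer, reading the last older term at `(□₀, φ₀)`), the reading `ρ`, the activity reading `h`
  refine ⟨fun k => ⟨(domSys P M (k + 1)).Dom, fun Z => {Z}, fun Z _ old _ => ((cZ k Z : ℝ) : ℂ) * old ⟨k, lt_add_one k⟩ (cubeDom P M k 0) φ₀⟩,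
    fun k old => old ⟨k, lt_add_one k⟩ (cubeDom P M k 0) φ₀, fun k _ _ Z p => ((cZ k Z : ℝ) : ℂ) * p, A, R₃₈, 0, hApos, le_rfl,
    by simp [hR₃₈, hc₁], ?_, ?_, ?_, ?_, ?_⟩
  · -- `hsmall` with equality
    have e1 : (5 : ℝ) * 0 + 1 = 1 := by norm_num
    rw [e1]
    have : A * Real.exp 1 * Kc * ν * c₁ = A * (Real.exp 1 * Kc * ν * c₁) := by ring
    rw [this, hA, inv_mul_cancel₀ hprod.ne']
  · -- (H-fact): the activity is the single generic term at `Z`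
    intro k t _ old _ X φ _ Z _
    show ∑ i ∈ ({Z} : Finset (domSys P M (k + 1)).Dom), ((cZ k i : ℝ) : ℂ) * old ⟨k, lt_add_one k⟩ (cubeDom P M k 0) φ₀ =
      ((cZ k Z : ℝ) : ℂ) * old ⟨k, lt_add_one k⟩ (cubeDom P M k 0) φ₀
    rw [Finset.sum_singleton]
  · -- (H-holo): linear in `p`
    intro k t _ X φ _ Z _
    exact (differentiableOn_const _).mul differentiableOn_id
  · -- (H-38): `‖c_Z · p‖ ≤ (A∕R)·e^{−R₃₈ d}·R = A·e^{−R₃₈ d}` on the ball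
    intro k t _ X φ _ Z _ p hp
    rw [mem_ball_zero_iff] at hp
    show ‖((cZ k Z : ℝ) : ℂ) * p‖ ≤ A * Real.exp (-(R₃₈ * (domSys P M (k + 1)).dj Z))
    rw [norm_mul, Complex.norm_real, Real.norm_of_nonneg (hcZpos k Z).le]
    calc cZ k Z * ‖p‖ ≤ cZ k Z * R := mul_le_mul_of_nonneg_left hp.le (hcZpos k Z).le
      _ = A * Real.exp (-(R₃₈ * (domSys P M (k + 1)).dj Z)) := by rw [hcZ]; field_simp
  · -- non-degeneracy: `h(0) = 0 ≠ c_Z·R∕2 = h(R∕2)`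
    intro k t φ Z
    show ((cZ k Z : ℝ) : ℂ) * 0 ≠ ((cZ k Z : ℝ) : ℂ) * ((R / 2 : ℝ) : ℂ)
    rw [mul_zero, ← Complex.ofReal_mul]
    intro h0
    have h1 : cZ k Z * (R / 2) = 0 := by exact_mod_cast h0.symm
    have h2 : 0 < cZ k Z * (R / 2) := mul_pos (hcZpos k Z) (by linarith)
    exact h2.ne' h1

open Classical in
/-- ★ **HENCE MODULE J57 §2's GENERATOR-LEVEL ROWS ARE INHABITED BY A HISTORY-READING GENERATOR** (`Pot k := ℂ`): there are a generator tower `G` (reading the last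
older term by evaluation), a reading `ρ`, an analytic reading `A′ k t φ X : ℂ → ℂ` and numerals `M_b`, `κ ≥ 0` with (AR-fact) `(G k).E t old φ X = A′ k t φ X (ρ k old)` (for ALL
`t, old, X, φ`), (AR-holo) on `ball 0 R` and (AR-bound) `‖A′ k t φ X p‖ ≤ M_b·e^{−κ d_{k+1}(X)}` there — module 101 `exists_genAnalyticReading_of_activityReading` on the witness
of `activityReading_rows_inhabited` (so `A′` is the (2.13) of the NON-constant activity family `p ↦ c_Z·p`). [folklore] -/
theorem genAnalyticReading_rows_inhabited (φ₀ : CPair P 𝔸) (hR : 0 < R) :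
    ∃ (G : GenTower P 𝔸 M) (ρ : (k : ℕ) → OlderTerms P 𝔸 M k → ℂ) (A' : (k : ℕ) → ℝ → CPair P 𝔸 → (domSys P M (k + 1)).Dom → ℂ → ℂ)
      (Mb κ : ℝ), 0 < Mb ∧ 0 ≤ κ ∧
      (∀ (k : ℕ), ∀ t ∈ Ioc (0 : ℝ) γ, ∀ (old : OlderTerms P 𝔸 M k), Adm k old → ∀ (X : (domSys P M (k + 1)).Dom), ∀ φ ∈ sp k X,
        (G k).E ((t : ℝ) : ℂ) old φ X = A' k t φ X (ρ k old)) ∧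
      (∀ (k : ℕ), ∀ t ∈ Ioc (0 : ℝ) γ, ∀ (X : (domSys P M (k + 1)).Dom), ∀ φ ∈ sp k X, DifferentiableOn ℂ (A' k t φ X) (ball 0 R)) ∧
      (∀ (k : ℕ), ∀ t ∈ Ioc (0 : ℝ) γ, ∀ (X : (domSys P M (k + 1)).Dom), ∀ φ ∈ sp k X, ∀ p ∈ ball (0 : ℂ) R,
        ‖A' k t φ X p‖ ≤ Mb * Real.exp (-(κ * (domSys P M (k + 1)).dj X))) := by
  obtain ⟨G, ρ, h, A, R₃₈, r₁, hA, hr₁, hrate, hsmall, hHA, hHh, hH38, -⟩ := activityReading_rows_inhabited sp Adm γ φ₀ hR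
  obtain ⟨A', h1, h2, h3⟩ := exists_genAnalyticReading_of_activityReading G sp Adm (Pot := fun _ => ℂ) ρ h hA.le hr₁ hrate hsmall hHA hHh hH38
  refine ⟨G, ρ, A', Real.exp 1 * (2 * (P.d : ℝ) + 1) * (4 * 2 ^ P.d) * K₀ (4 * 2 ^ P.d) (2 * P.d) ^ 2 * A, r₁, ?_, hr₁, h1, h2, h3⟩
  have hK : 0 < K₀ (4 * 2 ^ P.d) (2 * P.d) := K₀_pos _ _
  positivity

end YMDAG.N10

end
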